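import Summits.AtomisticToContinuum.Crystallization.Theorems.FreeSplittingCertificatesApproxFiniteRangeSplittingB

/-!
# FreeSplittingCertificates · ApproxFiniteRangeSplitting — part P2 (§9: §A–§C)

Part of the split landing of lens-1 g38 v3 `FreeSplittingCertificatesApproxFiniteRangeSplitting.lean` (sha256 6ca014fa…, 1642 l; module docstring of
record in part 1 `…ApproxFiniteRangeSplitting` / the lens file).  Declarations byte-identical; split for the 400-line rule by prover hand 1, gen 12
(decomp-a2c), --supports stmt-AtomisticToContinuum-12562 (the last part `…Holds` closes it).
-/

/-! ## §9 PROOF OF P2 `BlockAveragedRule` (g38 v2 addendum; 0 sorry; potential-agnostic)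

The Haar-averaged block rule. For a block side `L > 0` and a certificate family `W` (from the
hypothesis of P2: every finite injective pattern carries pair weights `w ≥ 0`, `w_ab + w_ba = 1`,
with site floor `f`), transported to point SETS and made translation-EQUIVARIANT by centroid
normalisation (§A), put, for a bond `0 → v` with recentred pattern `T`,

  `Φ(v,T) := L⁻³ ∫_{c ∈ ℝ³} g(c) dc`,  `g(c) := [0 ∈ Q_c] · ( [v ∈ Q_c] · W(Q_c ∩ ({0,v} ∪ T))(0,v) + [v ∉ Q_c] · ½ )`,

`Q_c := c + [0,L)³` (§B: `InCube`, `corner`, `block`, `gfun`; measurability via the finite cell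
decomposition `c ↦ Q_c ∩ U`; §C: `Phi`, box `0 ≤ Φ ≤ 1`). Complementarity `Φ(v,T) + Φ(−v,T−v) = 1`
is the change of variables `c ↦ c − v` (Lebesgue measure on `Fin 3 → ℝ` is add-invariant) plus the
pointwise identity `g_{v,T}(c) + g_{−v,T−v}(c − v) = ½·[0 ∈ Q_c] + ½·[v ∈ Q_c]` (§D). The floor
(§F): at a corner `c` with `x_i ∈ Q_c` every bond pattern of radius `√3·L` restricts to the SAME block
(cube diameter `< √3·L`, `block_eq_blk`), so the in-block bonds collect the block certificate's floor
`≥ f` (`floor_at_corner`) and each block-leaving bond costs at most `½ V⁻`; integrating, the loss is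
`½ Σ_j V⁻(r_ij) · vol{c : 0 ∈ Q_c, v_j ∉ Q_c}/L³ ≤ ½ Σ_j V⁻(r_ij) · min(1, √3 r_ij / L)` by the slab
bound `vol ≤ L² Σ_k |v_k| ≤ L²·√3‖v‖` (§E). §G assembles `blockAveragedRule_holds : BlockAveragedRule`.
-/

namespace Summit.AtomisticToContinuum.Crystallization.Theorems.FreeSplittingCertificatesApproxFiniteRangeSplitting.P2

open scoped BigOperators
open Classical

noncomputable section
/-- Auxiliary (lens-1 g38 `ApproxFiniteRangeSplitting` ladder). [folklore] -/

abbrev E3 := EuclideanSpace ℝ (Fin 3)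

variable (V : ℝ → ℝ) (f : ℝ)

/-- A boxed complementary splitting of the bonds of the finite set `S` with `V`-floor `f`,
with the diagonal convention `W p p = 0`. -/
def IsCert (S : Finset E3) (W : E3 → E3 → ℝ) : Prop :=
  (∀ p, W p p = 0) ∧
  (∀ p ∈ S, ∀ q ∈ S, p ≠ q → 0 ≤ W p q ∧ W p q + W q p = 1) ∧
  ∀ p ∈ S, f ≤ ∑ q ∈ S.erase p, W p q * V (dist p q)

/-- The hypothesis of `BlockAveragedRule`, verbatim. -/
def Hyp : Prop :=
  ∀ (n : ℕ) (y : Fin n → E3), Function.Injective y →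
    ∃ w : Fin n → Fin n → ℝ, (∀ a b, a ≠ b → 0 ≤ w a b ∧ w a b + w b a = 1) ∧
      ∀ a, f ≤ ∑ b ∈ Finset.univ.erase a, w a b * V (dist (y a) (y b))

/-- Transport of an indexed certificate to the point set it enumerates. -/
def certOfEnum {n : ℕ} (y : Fin n → E3) (w : Fin n → Fin n → ℝ) (p q : E3) : ℝ :=
  ∑ a : Fin n, if y a = p then (∑ b : Fin n, if y b = q then (if a = b then 0 else w a b) else 0) else 0
/-- Auxiliary (lens-1 g38 `ApproxFiniteRangeSplitting` ladder). [folklore] -/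

theorem certOfEnum_apply {n : ℕ} {y : Fin n → E3} (hy : Function.Injective y)
    (w : Fin n → Fin n → ℝ) (a b : Fin n) :
    certOfEnum y w (y a) (y b) = if a = b then 0 else w a b := by
  unfold certOfEnum
  simp only [hy.eq_iff]
  rw [Finset.sum_ite_eq' Finset.univ a, if_pos (Finset.mem_univ _)]
  rw [Finset.sum_ite_eq' Finset.univ b, if_pos (Finset.mem_univ _)]
/-- Auxiliary (lens-1 g38 `ApproxFiniteRangeSplitting` ladder). [folklore] -/

theorem certOfEnum_eq_zero_left {n : ℕ} {y : Fin n → E3} (w : Fin n → Fin n → ℝ) {p : E3}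
    (hp : ∀ a, y a ≠ p) (q : E3) : certOfEnum y w p q = 0 := by
  unfold certOfEnum
  exact Finset.sum_eq_zero fun a _ => by rw [if_neg (hp a)]
/-- Auxiliary (lens-1 g38 `ApproxFiniteRangeSplitting` ladder). [folklore] -/

theorem isCert_certOfEnum {n : ℕ} {y : Fin n → E3} (hy : Function.Injective y)
    {w : Fin n → Fin n → ℝ} (hw1 : ∀ a b, a ≠ b → 0 ≤ w a b ∧ w a b + w b a = 1)
    (hw2 : ∀ a, f ≤ ∑ b ∈ Finset.univ.erase a, w a b * V (dist (y a) (y b))) :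
    IsCert V f (Finset.univ.image y) (certOfEnum y w) := by
  refine ⟨?_, ?_, ?_⟩
  · intro p
    by_cases hp : ∃ a, y a = p
    · obtain ⟨a, rfl⟩ := hp
      rw [certOfEnum_apply hy]; simp
    · simp only [not_exists] at hp
      exact certOfEnum_eq_zero_left w hp p
  · intro p hp q hq hpq
    obtain ⟨a, -, rfl⟩ := Finset.mem_image.1 hp
    obtain ⟨b, -, rfl⟩ := Finset.mem_image.1 hq
    have hab : a ≠ b := fun h => hpq (by rw [h])
    have hba : b ≠ a := fun h => hab h.symm
    rw [certOfEnum_apply hy, certOfEnum_apply hy, if_neg hab, if_neg hba]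
    exact hw1 a b hab
  · intro p hp
    obtain ⟨a, -, rfl⟩ := Finset.mem_image.1 hp
    have himg : (Finset.univ.image y).erase (y a) = (Finset.univ.erase a).image y := by
      rw [Finset.image_erase hy]
    rw [himg, Finset.sum_image (fun b _ b' _ h => hy h)]
    refine (hw2 a).trans (le_of_eq ?_)
    refine Finset.sum_congr rfl fun b hb => ?_
    rw [certOfEnum_apply hy, if_neg (Finset.ne_of_mem_erase hb).symm]
/-- Auxiliary (lens-1 g38 `ApproxFiniteRangeSplitting` ladder). [folklore] -/

theorem exists_cert (h : Hyp V f) (S : Finset E3) : ∃ W, IsCert V f S W := by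
  set n := S.card
  let e : S ≃ Fin n := S.equivFin
  let y : Fin n → E3 := fun a => ((e.symm a : S) : E3)
  have hy : Function.Injective y := by
    intro a b hab
    exact e.symm.injective (Subtype.ext hab)
  have hS : Finset.univ.image y = S := by
    ext q
    constructor
    · intro hq
      obtain ⟨a, -, rfl⟩ := Finset.mem_image.1 hq
      exact (e.symm a).property
    · intro hq
      exact Finset.mem_image.2 ⟨e ⟨q, hq⟩, Finset.mem_univ _, by simp [y]⟩
  obtain ⟨w, hw1, hw2⟩ := h n y hy
  exact ⟨certOfEnum y w, hS ▸ isCert_certOfEnum V f hy hw1 hw2⟩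

/-- A chosen certificate for every finite point set (no equivariance yet). -/
def rawCert (h : Hyp V f) (S : Finset E3) : E3 → E3 → ℝ := (exists_cert V f h S).choose
/-- Auxiliary (lens-1 g38 `ApproxFiniteRangeSplitting` ladder). [folklore] -/

theorem rawCert_isCert (h : Hyp V f) (S : Finset E3) : IsCert V f S (rawCert V f h S) :=
  (exists_cert V f h S).choose_spec

/-! ### Centroid normalisation ⇒ translation-equivariant certificates -/

/-- Centroid of a finite point set (`0` for the empty set). -/
def centroid (S : Finset E3) : E3 := ((S.card : ℝ)⁻¹) • ∑ p ∈ S, p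
/-- Auxiliary (lens-1 g38 `ApproxFiniteRangeSplitting` ladder). [folklore] -/

theorem centroid_image_sub (S : Finset E3) (hS : S.Nonempty) (u : E3) :
    centroid (S.image fun p => p - u) = centroid S - u := by
  unfold centroid
  have hinj : Function.Injective fun p : E3 => p - u := sub_left_injective
  rw [Finset.card_image_of_injective _ hinj, Finset.sum_image (fun a _ b _ h => hinj h),
    Finset.sum_sub_distrib, Finset.sum_const, smul_sub, ← Nat.cast_smul_eq_nsmul ℝ, smul_smul,
    inv_mul_cancel₀ (by exact_mod_cast hS.card_pos.ne'), one_smul]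

/-- THE EQUIVARIANT CERTIFICATE FAMILY: normalise by the centroid, then use the chosen one. -/
def cert (h : Hyp V f) (S : Finset E3) (p q : E3) : ℝ :=
  rawCert V f h (S.image fun r => r - centroid S) (p - centroid S) (q - centroid S)
/-- Auxiliary (lens-1 g38 `ApproxFiniteRangeSplitting` ladder). [folklore] -/

theorem cert_shift (h : Hyp V f) {S : Finset E3} (hS : S.Nonempty) (u p q : E3) :
    cert V f h (S.image fun r => r - u) (p - u) (q - u) = cert V f h S p q := by
  unfold cert
  rw [centroid_image_sub S hS u, Finset.image_image]
  have h1 : ((fun r => r - (centroid S - u)) ∘ fun r => r - u) = fun r : E3 => r - centroid S := by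
    funext r; simp only [Function.comp]; abel
  rw [h1, sub_sub_sub_cancel_right, sub_sub_sub_cancel_right]
/-- Auxiliary (lens-1 g38 `ApproxFiniteRangeSplitting` ladder). [folklore] -/

theorem cert_isCert (h : Hyp V f) (S : Finset E3) : IsCert V f S (cert V f h S) := by
  obtain ⟨h0, h1, h2⟩ := rawCert_isCert V f h (S.image fun r => r - centroid S)
  have hinj : Function.Injective fun r : E3 => r - centroid S := sub_left_injective
  have hmem : ∀ {p}, p ∈ S → p - centroid S ∈ S.image fun r => r - centroid S :=
    fun hp => Finset.mem_image_of_mem _ hp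
  refine ⟨fun p => h0 _, ?_, ?_⟩
  · intro p hp q hq hpq
    exact h1 _ (hmem hp) _ (hmem hq) (fun h => hpq (hinj h))
  · intro p hp
    have := h2 _ (hmem hp)
    rw [← Finset.image_erase hinj, Finset.sum_image (fun a _ b _ h => hinj h)] at this
    unfold cert
    simpa only [dist_sub_right] using this

/-- Values in `[0,1]` on the set (including the diagonal). -/
theorem cert_mem_Icc (h : Hyp V f) {S : Finset E3} {p q : E3} (hp : p ∈ S) (hq : q ∈ S) :
    0 ≤ cert V f h S p q ∧ cert V f h S p q ≤ 1 := by
  obtain ⟨h0, h1, -⟩ := cert_isCert V f h S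
  by_cases hpq : p = q
  · subst hpq; rw [h0]; exact ⟨le_rfl, zero_le_one⟩
  · have a := h1 p hp q hq hpq
    have b := h1 q hq p hp (fun h => hpq h.symm)
    exact ⟨a.1, by linarith [a.2, b.1]⟩
/-- Auxiliary (lens-1 g38 `ApproxFiniteRangeSplitting` ladder). [folklore] -/

theorem cert_add_symm (h : Hyp V f) {S : Finset E3} {p q : E3} (hp : p ∈ S) (hq : q ∈ S)
    (hpq : p ≠ q) : cert V f h S p q + cert V f h S q p = 1 :=
  ((cert_isCert V f h S).2.1 p hp q hq hpq).2
/-- Auxiliary (lens-1 g38 `ApproxFiniteRangeSplitting` ladder). [folklore] -/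

theorem cert_floor (h : Hyp V f) {S : Finset E3} {p : E3} (hp : p ∈ S) :
    f ≤ ∑ q ∈ S.erase p, cert V f h S p q * V (dist p q) :=
  (cert_isCert V f h S).2.2 p hp


/-! ## §B Cubes, corners, blocks, the averaged weight `gfun`, measurability -/

variable (L : ℝ)

/-- `u ∈ Q_c := c + [0,L)³`, phrased on the corner offset `c`: `u k - L < c k ≤ u k`. -/
def InCube (c : Fin 3 → ℝ) (u : E3) : Prop := ∀ k, u k - L < c k ∧ c k ≤ u k

/-- The set of corner offsets whose cube contains `u`. -/
def corner (u : E3) : Set (Fin 3 → ℝ) := Set.univ.pi fun k => Set.Ioc (u k - L) (u k)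
/-- Auxiliary (lens-1 g38 `ApproxFiniteRangeSplitting` ladder). [folklore] -/

theorem mem_corner {c : Fin 3 → ℝ} {u : E3} : c ∈ corner L u ↔ InCube L c u := by
  simp [corner, InCube, Set.mem_pi, Set.mem_Ioc]
/-- Auxiliary (lens-1 g38 `ApproxFiniteRangeSplitting` ladder). [folklore] -/

theorem setOf_inCube (u : E3) : {c : Fin 3 → ℝ | InCube L c u} = corner L u := by
  ext c; rw [Set.mem_setOf_eq, mem_corner]
/-- Auxiliary (lens-1 g38 `ApproxFiniteRangeSplitting` ladder). [folklore] -/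

theorem measurableSet_corner (u : E3) : MeasurableSet (corner L u) :=
  MeasurableSet.univ_pi fun _ => measurableSet_Ioc
/-- Auxiliary (lens-1 g38 `ApproxFiniteRangeSplitting` ladder). [folklore] -/

theorem volume_corner (u : E3) : MeasureTheory.volume (corner L u) = ENNReal.ofReal L ^ 3 := by
  unfold corner
  rw [Real.volume_pi_Ioc]
  simp
/-- Auxiliary (lens-1 g38 `ApproxFiniteRangeSplitting` ladder). [folklore] -/

theorem volume_corner_toReal (hL : 0 ≤ L) (u : E3) :
    (MeasureTheory.volume (corner L u)).toReal = L ^ 3 := by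
  rw [volume_corner, ENNReal.toReal_pow, ENNReal.toReal_ofReal hL]
/-- Auxiliary (lens-1 g38 `ApproxFiniteRangeSplitting` ladder). [folklore] -/

theorem volume_corner_lt_top (u : E3) : MeasureTheory.volume (corner L u) < ⊤ := by
  rw [volume_corner]
  exact ENNReal.pow_lt_top ENNReal.ofReal_lt_top

/-- The sub-pattern of `U` inside the cube with corner `c`. -/
def block (c : Fin 3 → ℝ) (U : Finset E3) : Finset E3 := U.filter fun u => InCube L c u
/-- Auxiliary (lens-1 g38 `ApproxFiniteRangeSplitting` ladder). [folklore] -/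

theorem mem_block {c : Fin 3 → ℝ} {U : Finset E3} {u : E3} :
    u ∈ block L c U ↔ u ∈ U ∧ InCube L c u := Finset.mem_filter

/-- The cell of offsets on which the block of `U` equals `A`. -/
def cell (U A : Finset E3) : Set (Fin 3 → ℝ) := {c | ∀ u ∈ U, InCube L c u ↔ u ∈ A}
/-- Auxiliary (lens-1 g38 `ApproxFiniteRangeSplitting` ladder). [folklore] -/

theorem measurableSet_cell (U A : Finset E3) : MeasurableSet (cell L U A) := by
  have : cell L U A = ⋂ u ∈ U, {c : Fin 3 → ℝ | InCube L c u ↔ u ∈ A} := by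
    ext c; simp [cell, Set.mem_iInter]
  rw [this]
  refine Finset.measurableSet_biInter U fun u _ => ?_
  by_cases hu : u ∈ A
  · have h1 : {c : Fin 3 → ℝ | InCube L c u ↔ u ∈ A} = corner L u := by
      ext c; simp only [hu, iff_true, Set.mem_setOf_eq, mem_corner]
    rw [h1]; exact measurableSet_corner L u
  · have h1 : {c : Fin 3 → ℝ | InCube L c u ↔ u ∈ A} = (corner L u)ᶜ := by
      ext c; simp only [hu, iff_false, Set.mem_setOf_eq, Set.mem_compl_iff, mem_corner]
    rw [h1]; exact (measurableSet_corner L u).compl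
/-- Auxiliary (lens-1 g38 `ApproxFiniteRangeSplitting` ladder). [folklore] -/

theorem mem_cell_iff {U A : Finset E3} (hA : A ⊆ U) {c : Fin 3 → ℝ} :
    c ∈ cell L U A ↔ block L c U = A := by
  constructor
  · intro h
    ext u
    rw [mem_block]
    constructor
    · rintro ⟨hu, hc⟩; exact (h u hu).1 hc
    · intro huA; exact ⟨hA huA, (h u (hA huA)).2 huA⟩
  · rintro rfl u hu
    rw [mem_block]
    exact ⟨fun hc => ⟨hu, hc⟩, fun h => h.2⟩
/-- Auxiliary (lens-1 g38 `ApproxFiniteRangeSplitting` ladder). [folklore] -/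

theorem sum_indicator_cell (U : Finset E3) (val : Finset E3 → ℝ) (c : Fin 3 → ℝ) :
    ∑ A ∈ U.powerset, (cell L U A).indicator (fun _ => val A) c = val (block L c U) := by
  have hmem : block L c U ∈ U.powerset := Finset.mem_powerset.2 (Finset.filter_subset _ U)
  rw [Finset.sum_eq_single_of_mem (block L c U) hmem]
  · rw [Set.indicator_of_mem]
    exact (mem_cell_iff L (Finset.filter_subset _ U)).2 rfl
  · intro A hA hne
    rw [Set.indicator_of_notMem]
    intro hc
    exact hne ((mem_cell_iff L (Finset.mem_powerset.1 hA)).1 hc).symm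
/-- Auxiliary (lens-1 g38 `ApproxFiniteRangeSplitting` ladder). [folklore] -/

theorem measurable_comp_block (U : Finset E3) (val : Finset E3 → ℝ) :
    Measurable fun c : Fin 3 → ℝ => val (block L c U) := by
  have : (fun c : Fin 3 → ℝ => val (block L c U)) =
      fun c => ∑ A ∈ U.powerset, (cell L U A).indicator (fun _ => val A) c := by
    funext c; rw [sum_indicator_cell]
  rw [this]
  refine Finset.measurable_sum _ fun A _ => ?_
  exact measurable_const.indicator (measurableSet_cell L U A)

/-- The weight integrand of the bond `0 → v` with pattern `T` at corner `c`: the block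
certificate's weight if the cube contains both endpoints, `½` if it contains `0` but not `v`,
`0` if it does not contain `0` (outside the averaging domain). -/
def gfun (W : Finset E3 → E3 → E3 → ℝ) (v : E3) (T : Finset E3) (c : Fin 3 → ℝ) : ℝ :=
  if InCube L c 0 then (if InCube L c v then W (block L c (insert 0 (insert v T))) 0 v else 1 / 2)
  else 0
/-- Auxiliary (lens-1 g38 `ApproxFiniteRangeSplitting` ladder). [folklore] -/

theorem measurable_gfun (W : Finset E3 → E3 → E3 → ℝ) (v : E3) (T : Finset E3) :
    Measurable (gfun L W v T) := by
  unfold gfun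
  refine Measurable.ite ?_ (Measurable.ite ?_ ?_ measurable_const) measurable_const
  · rw [setOf_inCube]; exact measurableSet_corner L 0
  · rw [setOf_inCube]; exact measurableSet_corner L v
  · exact measurable_comp_block L _ fun A => W A 0 v

/-- Box hypothesis on the certificate family: values in `[0,1]` between members. -/
def WBox (W : Finset E3 → E3 → E3 → ℝ) : Prop :=
  ∀ (A : Finset E3) (p q : E3), p ∈ A → q ∈ A → 0 ≤ W A p q ∧ W A p q ≤ 1
/-- Auxiliary (lens-1 g38 `ApproxFiniteRangeSplitting` ladder). [folklore] -/

theorem gfun_nonneg {W : Finset E3 → E3 → E3 → ℝ} (hW : WBox W) (v : E3) (T : Finset E3)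
    (c : Fin 3 → ℝ) : 0 ≤ gfun L W v T c := by
  unfold gfun
  split_ifs with h0 hv
  · refine (hW _ _ _ ?_ ?_).1
    · exact mem_block L |>.2 ⟨Finset.mem_insert_self _ _, h0⟩
    · exact mem_block L |>.2 ⟨Finset.mem_insert_of_mem (Finset.mem_insert_self _ _), hv⟩
  · norm_num
  · exact le_rfl
/-- Auxiliary (lens-1 g38 `ApproxFiniteRangeSplitting` ladder). [folklore] -/

theorem gfun_le_indicator {W : Finset E3 → E3 → E3 → ℝ} (hW : WBox W) (v : E3) (T : Finset E3)
    (c : Fin 3 → ℝ) : gfun L W v T c ≤ (corner L 0).indicator (fun _ => (1 : ℝ)) c := by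
  unfold gfun
  split_ifs with h0 hv
  · rw [Set.indicator_of_mem ((mem_corner L).2 h0)]
    refine (hW _ _ _ ?_ ?_).2
    · exact mem_block L |>.2 ⟨Finset.mem_insert_self _ _, h0⟩
    · exact mem_block L |>.2 ⟨Finset.mem_insert_of_mem (Finset.mem_insert_self _ _), hv⟩
  · rw [Set.indicator_of_mem ((mem_corner L).2 h0)]; norm_num
  · exact Set.indicator_nonneg (fun _ _ => zero_le_one) c
/-- Auxiliary (lens-1 g38 `ApproxFiniteRangeSplitting` ladder). [folklore] -/

theorem integrable_indicator_corner (u : E3) :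
    MeasureTheory.Integrable ((corner L u).indicator fun _ => (1 : ℝ)) := by
  rw [MeasureTheory.integrable_indicator_iff (measurableSet_corner L u)]
  exact MeasureTheory.integrableOn_const (volume_corner_lt_top L u).ne
/-- Auxiliary (lens-1 g38 `ApproxFiniteRangeSplitting` ladder). [folklore] -/

theorem integrable_gfun {W : Finset E3 → E3 → E3 → ℝ} (hW : WBox W) (v : E3) (T : Finset E3) :
    MeasureTheory.Integrable (gfun L W v T) := by
  refine MeasureTheory.Integrable.mono' (integrable_indicator_corner L 0)
    (measurable_gfun L W v T).aestronglyMeasurable (Filter.Eventually.of_forall fun c => ?_)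
  rw [Real.norm_eq_abs, abs_of_nonneg (gfun_nonneg L hW v T c)]
  exact gfun_le_indicator L hW v T c

/-! ## §C The rule `Phi` and its box property -/

/-- THE BLOCK-AVERAGED RULE. -/
def Phi (W : Finset E3 → E3 → E3 → ℝ) (v : E3) (T : Finset E3) : ℝ :=
  (L ^ 3)⁻¹ * ∫ c, gfun L W v T c
/-- Auxiliary (lens-1 g38 `ApproxFiniteRangeSplitting` ladder). [folklore] -/

theorem integral_gfun_nonneg {W : Finset E3 → E3 → E3 → ℝ} (hW : WBox W) (v : E3) (T : Finset E3) :
    0 ≤ ∫ c, gfun L W v T c :=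
  MeasureTheory.integral_nonneg fun c => gfun_nonneg L hW v T c
/-- Auxiliary (lens-1 g38 `ApproxFiniteRangeSplitting` ladder). [folklore] -/

theorem integral_gfun_le {W : Finset E3 → E3 → E3 → ℝ} (hW : WBox W) (hL : 0 ≤ L) (v : E3)
    (T : Finset E3) : ∫ c, gfun L W v T c ≤ L ^ 3 := by
  calc ∫ c, gfun L W v T c ≤ ∫ c, (corner L 0).indicator (fun _ => (1 : ℝ)) c :=
        MeasureTheory.integral_mono (integrable_gfun L hW v T) (integrable_indicator_corner L 0)
          fun c => gfun_le_indicator L hW v T c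
    _ = L ^ 3 := by
        rw [MeasureTheory.integral_indicator_const _ (measurableSet_corner L 0), smul_eq_mul, mul_one,
          MeasureTheory.measureReal_def, volume_corner_toReal L hL]
/-- Auxiliary (lens-1 g38 `ApproxFiniteRangeSplitting` ladder). [folklore] -/

theorem Phi_box {W : Finset E3 → E3 → E3 → ℝ} (hW : WBox W) (hL : 0 < L) (v : E3) (T : Finset E3) :
    0 ≤ Phi L W v T ∧ Phi L W v T ≤ 1 := by
  have hL3 : 0 < L ^ 3 := pow_pos hL 3
  unfold Phi
  refine ⟨mul_nonneg (inv_nonneg.2 hL3.le) (integral_gfun_nonneg L hW v T), ?_⟩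
  rw [inv_mul_le_iff₀ hL3, mul_one]
  exact integral_gfun_le L hW hL.le v T

end

end Summit.AtomisticToContinuum.Crystallization.Theorems.FreeSplittingCertificatesApproxFiniteRangeSplitting.P2
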